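import Summits.AtomisticToContinuum.HydrodynamicLimit.Theorems.TransferActivityTails.Negative.EquilibriumReduction
import Summits.AtomisticToContinuum.HydrodynamicLimit.Theorems.OneFlightGossipEngineCollisionActivityTailsEndpointTails
import HarnessLib

/-!
# `TwoClocks.TransferActivityTails` (stmt-AtomisticToContinuum-16624), line `Sketch` (card `predictor-drift-doob`):
# stub `stub_blockAverage`

Helper file (`--supports stmt-AtomisticToContinuum-16624`) for the crux
`Summit.AtomisticToContinuum.HydrodynamicLimit.Theses.TwoClocks.TransferActivityTails`, skeleton line `Sketch`
(`Cruxes/TransferActivityTails/Lines/Sketch.lean`), registered stub `stub_blockAverage : BlockAverage`.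

**Block average identity** (kinematics of `collisionSum` on the good set).  Cut the window `(s, s + w]`,
`w = window ((K+1) τ₁) N = (K+1) w₁`, `w₁ = window τ₁ N = τ₁ (N+1)^{-1/3}`, into the `K + 1` consecutive blocks
`(s + j w₁, s + (j+1) w₁]`, `j ≤ K`.  On the good set of the flow every bounded window carries finitely many collision
times (`HardSphereFlow.finite_collisionTimes_inter`), so the `finsum` defining the collision sum is an honest finite
sum, additive over the partition (`collisionPairSum_union`, `Set.Ioc_union_Ioc_eq_Ioc`); dividing by `(K+1) τ₁`,
the window transfer activity at `τ = (K+1) τ₁` IS the average of the `K + 1` block activities: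

`(σ/((K+1)τ₁)) Σ_{(s, s + (K+1)w₁]} transferOf = (K+1)⁻¹ Σ_{j ≤ K} (σ/τ₁) Σ_{(s + jw₁, s + (j+1)w₁]} transferOf`.

The proofs are ported from the momentum-summand template `CollisionActivityTailsWindowAlgebra`
(`impulse_Ioc_add`, `impulse_Ioc_eq_sum`, `act_succ_mul_eq_avg` of
`…OneFlightGossipEngineCollisionActivityTailsActMeasurable`), stated here for a general summand of the record.
The identity is linear in `σ` (any real); only `0 < τ₁` (so that `w₁ ≥ 0` and the blocks are consecutive) is used.
-/

noncomputable section

open MeasureTheory Filter Set Topology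
open scoped ENNReal BigOperators

namespace Summit.AtomisticToContinuum.HydrodynamicLimit.Theorems.TransferActivityTailsDriftBlockAverage

open Literature.MathematicalPhysics.KineticTheory Literature.Analysis.FluidPDE
open Summit.AtomisticToContinuum.HydrodynamicLimit.Theorems.TransferActivityTailsNegative (Flow Rec transferOf)
open Summit.AtomisticToContinuum.HydrodynamicLimit.Theorems.CollisionActivityTailsEndpointTails
  (Cfg window ae_mem_good_localGibbsLaw)

/-! ## The statement (verbatim from the line skeleton `Sketch`) -/

/-- **Block transfer activity** `X_{i,j}(s)`: the crux's transfer activity of particle `i` restricted to the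
`j`-th block `(s + j·w₁, s + (j+1)·w₁]`, `w₁ = window τ₁ N = τ₁ (N+1)^{-1/3}`, normalised per block (prefactor
`σ/τ₁`) — vocabulary of line `Sketch`, crux TransferActivityTails (stmt-AtomisticToContinuum-16624). -/
def BlockAct (σ τ₁ : ℝ) {N : ℕ} (Φ : Flow σ N) (i : Fin (N + 1)) (j : ℕ) (s : ℝ) (z : Cfg N) : ℝ :=
  σ / τ₁ * Φ.collisionSum (Set.Ioc (s + j * window τ₁ N) (s + (j + 1) * window τ₁ N)) (transferOf N i) z

/-- **Block average identity** (kinematics of `collisionSum` on the good set): the window activity at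
`τ = (K+1)τ₁` is the average of the `K+1` block activities,
`(σ/((K+1)τ₁)) Σ_{(s, s + (K+1)w₁]} = (K+1)⁻¹ Σ_{j ≤ K} (σ/τ₁) Σ_{(s + jw₁, s + (j+1)w₁]}` — registered stub
signature of line `Sketch`, crux TransferActivityTails (stmt-AtomisticToContinuum-16624). -/
def BlockAverage : Prop :=
  ∀ (σ : ℝ) (N : ℕ) (Φ : Flow σ N) (z : Cfg N), z ∈ Φ.good → ∀ (τ₁ : ℝ), 0 < τ₁ → ∀ (s : ℝ) (i : Fin (N + 1))
    (K : ℕ),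
    σ / ((K + 1) * τ₁) * Φ.collisionSum (Set.Ioc s (s + window ((K + 1) * τ₁) N)) (transferOf N i) z =
      ((K : ℝ) + 1)⁻¹ * ∑ j ∈ Finset.range (K + 1), BlockAct σ τ₁ Φ i j s z

/-! ## Window algebra on the good set (general summand of the record) -/

variable {σ : ℝ} {N : ℕ}

/-- **Additivity of collision sums along the flow over adjacent windows** `(a, c] = (a, b] ∪ (b, c]` on the good set
(finitely many collision times in bounded windows, `collisionPairSum_union`). -/
theorem collisionSum_Ioc_add (Φ : Flow σ N) {z : Cfg N} (hz : z ∈ Φ.good) {a b c : ℝ} (hab : a ≤ b)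
    (hbc : b ≤ c) (F : Rec N → ℝ) :
    Φ.collisionSum (Ioc a c) F z = Φ.collisionSum (Ioc a b) F z + Φ.collisionSum (Ioc b c) F z := by
  -- adapted from `CollisionActivityTailsWindowAlgebra.impulse_Ioc_add` (momentum summand), general summand here
  rw [HardSphereFlow.collisionSum_eq, HardSphereFlow.collisionSum_eq, HardSphereFlow.collisionSum_eq,
    Literature.Analysis.FluidPDE.collisionSum_eq_collisionPairSum,
    Literature.Analysis.FluidPDE.collisionSum_eq_collisionPairSum,
    Literature.Analysis.FluidPDE.collisionSum_eq_collisionPairSum, ← Ioc_union_Ioc_eq_Ioc hab hbc,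
    collisionPairSum_union (Φ.finite_collisionTimes_inter hz Ioc_subset_Icc_self)
      (Φ.finite_collisionTimes_inter hz Ioc_subset_Icc_self) (Ioc_disjoint_Ioc_of_le le_rfl)]

/-- **Block decomposition.** The collision sum over `(s, s + (K+1) w]` is the sum of the collision sums over the
`K + 1` consecutive blocks `(s + j w, s + (j+1) w]`, `j ≤ K`, of length `w ≥ 0` (good set; induction on `K`). -/
theorem collisionSum_Ioc_eq_sum (Φ : Flow σ N) {z : Cfg N} (hz : z ∈ Φ.good) {w : ℝ} (hw : 0 ≤ w) (s : ℝ)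
    (F : Rec N → ℝ) (K : ℕ) :
    Φ.collisionSum (Ioc s (s + ((K : ℝ) + 1) * w)) F z =
      ∑ j ∈ Finset.range (K + 1), Φ.collisionSum (Ioc (s + j * w) (s + ((j : ℝ) + 1) * w)) F z := by
  -- adapted from `CollisionActivityTailsWindowAlgebra.impulse_Ioc_eq_sum`
  induction K with
  | zero => simp
  | succ K ih =>
    rw [Finset.sum_range_succ, ← ih, collisionSum_Ioc_add Φ hz (b := s + ((K : ℝ) + 1) * w)]
    · push_cast
      ring_nf
    · nlinarith
    · push_cast
      nlinarith

/-! ## The registered stub -/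

/-- **STUB `stub_blockAverage` (line `Sketch`)**: on the good set the window transfer activity at `τ = (K+1) τ₁` is
the average of the `K + 1` block transfer activities (`collisionSum_Ioc_eq_sum` with `w = window τ₁ N ≥ 0`,
`window ((K+1) τ₁) N = (K+1) window τ₁ N`, and `σ/((K+1) τ₁) = (K+1)⁻¹ · σ/τ₁`). -/
theorem stub_blockAverage : BlockAverage := by
  intro σ N Φ z hz τ₁ hτ₁ s i K
  -- adapted from `CollisionActivityTailsWindowAlgebra.act_succ_mul_eq_avg` (momentum summand); the window is linear
  -- and nonnegative in `τ` (one `ring` / `positivity` here on this line's copy of `window`, rather than an import of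
  -- `CollisionActivityTailsWindowAlgebra.window_mul`, which speaks of another copy of `window`)
  have hwin : window (((K : ℝ) + 1) * τ₁) N = ((K : ℝ) + 1) * window τ₁ N := by
    unfold window
    ring
  have hw : 0 ≤ window τ₁ N := by
    unfold window
    positivity
  rw [hwin, collisionSum_Ioc_eq_sum Φ hz hw s (transferOf N i) K, Finset.mul_sum, Finset.mul_sum]
  refine Finset.sum_congr rfl fun j _ => ?_
  simp only [BlockAct, div_eq_mul_inv, mul_inv]
  ring

end Summit.AtomisticToContinuum.HydrodynamicLimit.Theorems.TransferActivityTailsDriftBlockAverage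

end
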